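import Summits.Ventures.PercRepro.RankLevelSetCycleCount
import Summits.Ventures.PercRepro.RankLevelSetNormSkew

/-! # RankLevelSetBoolInOut — THE BOOLEAN (IO) IS A THEOREM: EVERY INTERSECTING UP-SET `V ⊆ 2^[n]` HAS
`NormSkew v (n + 1)` — KATONA'S CYCLE METHOD, PART 4: THE AVERAGING AND THE ASSEMBLY (night-1 g33; dossier §45)

For an intersecting up-set `V` of subsets of a finite type `α` with `n` elements and its level profile
`v_k = levelCount V k = #{W ∈ V : #W = k}`, the cell's conjecture (IO) in the free matroid (dossier §44.3, census
0 / 7,828,354 up-sets of `2^[6]`) reads `SkewConv.NormSkew v (n + 1)`: `v_i · C(n+1, j) ≤ v_j · C(n+1, i)` for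
`i < j`, `i + j ≤ n + 1`. It is equivalent to its consecutive steps `(n + 1 − k) v_k ≤ (k + 1) v_{k+1}` (`2k ≤ n`) and
its reflection pairs `v_i ≤ v_{n+1−i}` (`2i ≤ n`) (**`SkewConv.normSkew_of_step_of_reflect`**, a statement about
sequences). Both are proved by KATONA'S CYCLE METHOD (Katona 1972): the per-cycle inequalities of
`RankLevelSetCycleStep` are summed over all cyclic orders with the fibre counts of `RankLevelSetCycleCount`:
`2 · v_k · #fib ≤ (n − k) · 2 · #bdryPairs · #fib₂` with `#fib = (n − k) · #fib₂` gives `v_k ≤ #bdryPairs V k`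
(**`levelCount_le_card_bdryPairs`**), and the double counting `#bdryPairs V k + (n − k) v_k = (k + 1) v_{k+1}`
(**`card_bdryPairs_add`**) turns it into the step (**`step_levelCount`**); the reflection inequality summed gives
`(n − i) v_{i+1} #fib(i+1) ≤ (i + 1) v_{n−i} #fib(n−i)`, and `#fib(m) · C(n, m) = #pairs` for both `m` with
`(n − i) C(n, i) = (i + 1) C(n, i+1)` gives `v_{i+1} ≤ v_{n−i}` (**`levelCount_le_levelCount_reflect`**).
THE THEOREM: **`normSkew_levelCount_of_intersecting`** (`Fintype.card α = n`, any `n`) and its form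
**`normSkew_levelCount_of_intersecting'`** with parameter `Fintype.card α + 1`. The star `{W ∋ x}` is tight at every
reflection pair, so the parameter `n + 1` is sharp. Every declaration has a docstring; imports: the cell's
`RankLevelSetCycleCount`, `RankLevelSetNormSkew` and Mathlib only. Axioms: standard. -/

namespace PercRepro

/-! ## Sequences: `NormSkew` from its steps and its reflections -/

namespace SkewConv

/-- The chain of consecutive steps: `v i · C(N, i + d) ≤ v (i + d) · C(N, i)` whenever `2(i + d) ≤ N + 1`. -/
lemma chain_of_step {v : ℕ → ℕ} {N : ℕ}
    (hstep : ∀ k, 2 * k + 1 ≤ N → v k * N.choose (k + 1) ≤ v (k + 1) * N.choose k) (i : ℕ) :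
    ∀ d, 2 * (i + d) ≤ N + 1 → v i * N.choose (i + d) ≤ v (i + d) * N.choose i := by
  intro d
  induction d with
  | zero => intro _; simp
  | succ d ih =>
    intro hd
    have h1 := ih (by omega)
    have h2 := hstep (i + d) (by omega)
    have hpos : 0 < N.choose (i + d) := Nat.choose_pos (by omega)
    rw [← Nat.add_assoc]
    refine Nat.le_of_mul_le_mul_right (c := N.choose (i + d)) ?_ hpos
    calc v i * N.choose (i + d + 1) * N.choose (i + d) = (v i * N.choose (i + d)) * N.choose (i + d + 1) := by ring
      _ ≤ (v (i + d) * N.choose i) * N.choose (i + d + 1) := Nat.mul_le_mul_right _ h1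
      _ = N.choose i * (v (i + d) * N.choose (i + d + 1)) := by ring
      _ ≤ N.choose i * (v (i + d + 1) * N.choose (i + d)) := Nat.mul_le_mul_left _ h2
      _ = v (i + d + 1) * N.choose i * N.choose (i + d) := by ring

/-- **`NormSkew` from its consecutive steps and its reflection pairs**: if `v k · C(N, k+1) ≤ v (k+1) · C(N, k)`
for `2k + 1 ≤ N` and `v i ≤ v (N − i)` for `2i < N`, then `NormSkew v N`. -/
theorem normSkew_of_step_of_reflect {v : ℕ → ℕ} {N : ℕ}
    (hstep : ∀ k, 2 * k + 1 ≤ N → v k * N.choose (k + 1) ≤ v (k + 1) * N.choose k)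
    (hrefl : ∀ i, 2 * i < N → v i ≤ v (N - i)) : NormSkew v N := by
  intro i j hij hR
  rcases le_or_gt (2 * j) (N + 1) with hj | hj
  · have := chain_of_step hstep i (j - i) (by omega)
    rwa [Nat.add_sub_cancel' hij.le] at this
  · -- reflect `j` to `j' = N − j ≥ i`, chain to `j'`, then reflect
    have hj' : i ≤ N - j := by omega
    have h1 := chain_of_step hstep i (N - j - i) (by omega)
    rw [Nat.add_sub_cancel' hj'] at h1
    have h2 : v (N - j) ≤ v j := by
      have := hrefl (N - j) (by omega)
      rwa [Nat.sub_sub_self (by omega : j ≤ N)] at this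
    have hc : N.choose (N - j) = N.choose j := Nat.choose_symm (by omega)
    rw [hc] at h1
    exact h1.trans (Nat.mul_le_mul_right _ h2)

end SkewConv

namespace Cycle

open Finset

variable {α : Type} [Fintype α] [DecidableEq α] {n : ℕ} [NeZero n]

/-! ## The double counting of the boundary pairs -/

/-- The fibre of a pair-family over a first component `W` is the image of a set of second components. -/
lemma card_filter_fst_eq (Q : Finset (Finset α × α)) (W : Finset α) :
    ({q ∈ Q | q.1 = W}).card = ((univ.filter (fun e => (W, e) ∈ Q))).card := by
  symm
  apply Finset.card_nbij' (fun e => (W, e)) (fun q => q.2)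
  · intro e he
    rw [Finset.mem_coe, Finset.mem_filter] at he ⊢
    exact ⟨he.2, rfl⟩
  · intro q hq
    rw [Finset.mem_coe, Finset.mem_filter] at hq ⊢
    refine ⟨Finset.mem_univ _, ?_⟩
    rw [← hq.2]
    exact hq.1
  · intro e _; rfl
  · intro q hq
    rw [Finset.mem_coe, Finset.mem_filter] at hq
    exact Prod.ext hq.2.symm rfl

omit [NeZero n] in
/-- **The boundary pairs complete the member pairs**: for an up-set `V`,
`#bdryPairs V k + (n − k) · v_k = (k + 1) · v_{k+1}` (count the pairs `(W, e)` with `W ∈ V`, `#W = k + 1`,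
`e ∈ W`, by whether `W ∖ {e} ∈ V`). -/
theorem card_bdryPairs_add (hn : Fintype.card α = n) {V : Finset (Finset α)}
    (hup : IsUpperSet (V : Set (Finset α))) (k : ℕ) :
    (bdryPairs V k).card + (n - k) * levelCount V k = (k + 1) * levelCount V (k + 1) := by
  -- the pairs `(L, e)` with `e ∉ L`, `#L = k`, `insert e L ∈ V`
  set P : Finset (Finset α × α) :=
    univ.filter (fun q : Finset α × α => q.2 ∉ q.1 ∧ q.1.card = k ∧ insert q.2 q.1 ∈ V) with hP
  -- the pairs `(W, e)` with `W ∈ V`, `#W = k + 1`, `e ∈ W`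
  set Q : Finset (Finset α × α) :=
    univ.filter (fun q : Finset α × α => q.1 ∈ V ∧ q.1.card = k + 1 ∧ q.2 ∈ q.1) with hQ
  -- `P` splits into the boundary pairs and the pairs with `L ∈ V`
  have hsplit : (bdryPairs V k).card + (P.filter (fun q => q.1 ∈ V)).card = P.card := by
    rw [← Finset.card_filter_add_card_filter_not (s := P) (fun q => q.1 ∉ V)]
    congr 2
    · ext q; simp only [bdryPairs, hP, Finset.mem_filter, Finset.mem_univ, true_and]; tauto
    · ext q; simp only [Finset.mem_filter, not_not]
  -- the pairs with `L ∈ V` number `(n − k) · v_k`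
  have hin : (P.filter (fun q => q.1 ∈ V)).card = (n - k) * levelCount V k := by
    have hmaps : ((P.filter (fun q => q.1 ∈ V) : Finset (Finset α × α)) : Set _).MapsTo
        (fun q : Finset α × α => q.1) ((V.filter (fun W => W.card = k) : Finset (Finset α)) : Set _) := by
      intro q hq
      rw [Finset.mem_coe, Finset.mem_filter, hP, Finset.mem_filter] at hq
      rw [Finset.mem_coe, Finset.mem_filter]
      exact ⟨hq.2, hq.1.2.2.1⟩
    rw [Finset.card_eq_sum_card_fiberwise hmaps]
    have : ∀ L ∈ V.filter (fun W => W.card = k),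
        ({q ∈ P.filter (fun q => q.1 ∈ V) | q.1 = L}).card = n - k := by
      intro L hL
      rw [Finset.mem_filter] at hL
      rw [card_filter_fst_eq]
      have heq : univ.filter (fun e => (L, e) ∈ P.filter (fun q => q.1 ∈ V)) = univ \ L := by
        ext e
        simp only [Finset.mem_filter, Finset.mem_univ, true_and, hP, Finset.mem_sdiff]
        constructor
        · exact fun h => h.1.1
        · intro he
          refine ⟨⟨he, hL.2, hup (Finset.coe_subset.mpr (Finset.subset_insert e L)) hL.1⟩, hL.1⟩
      rw [heq, Finset.card_sdiff_of_subset (Finset.subset_univ L), Finset.card_univ, hn, hL.2]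
    rw [Finset.sum_congr rfl this, Finset.sum_const, smul_eq_mul, mul_comm]
    rfl
  -- `P` and `Q` are in bijection
  have hPQ : P.card = Q.card := by
    apply Finset.card_nbij' (fun q => (insert q.2 q.1, q.2)) (fun q => (q.1.erase q.2, q.2))
    · intro q hq
      rw [Finset.mem_coe, hP, Finset.mem_filter] at hq
      rw [Finset.mem_coe, hQ, Finset.mem_filter]
      refine ⟨Finset.mem_univ _, hq.2.2.2, ?_, Finset.mem_insert_self _ _⟩
      rw [Finset.card_insert_of_notMem hq.2.1, hq.2.2.1]
    · intro q hq
      rw [Finset.mem_coe, hQ, Finset.mem_filter] at hq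
      rw [Finset.mem_coe, hP, Finset.mem_filter]
      refine ⟨Finset.mem_univ _, Finset.notMem_erase _ _, ?_, ?_⟩
      · rw [Finset.card_erase_of_mem hq.2.2.2, hq.2.2.1]; rfl
      · rw [Finset.insert_erase hq.2.2.2]; exact hq.2.1
    · intro q hq
      rw [Finset.mem_coe, hP, Finset.mem_filter] at hq
      simp only [Finset.erase_insert hq.2.1]
    · intro q hq
      rw [Finset.mem_coe, hQ, Finset.mem_filter] at hq
      simp only [Finset.insert_erase hq.2.2.2]
  -- `Q` numbers `(k + 1) · v_{k+1}`
  have hQcard : Q.card = (k + 1) * levelCount V (k + 1) := by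
    have hmaps : ((Q : Finset (Finset α × α)) : Set _).MapsTo
        (fun q : Finset α × α => q.1) ((V.filter (fun W => W.card = k + 1) : Finset (Finset α)) : Set _) := by
      intro q hq
      rw [Finset.mem_coe, hQ, Finset.mem_filter] at hq
      rw [Finset.mem_coe, Finset.mem_filter]
      exact ⟨hq.2.1, hq.2.2.1⟩
    rw [Finset.card_eq_sum_card_fiberwise hmaps]
    have : ∀ W ∈ V.filter (fun W => W.card = k + 1), ({q ∈ Q | q.1 = W}).card = k + 1 := by
      intro W hW
      rw [Finset.mem_filter] at hW
      rw [card_filter_fst_eq]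
      have heq : univ.filter (fun e => (W, e) ∈ Q) = W := by
        ext e
        simp only [Finset.mem_filter, Finset.mem_univ, true_and, hQ]
        exact ⟨fun h => h.2.2, fun h => ⟨hW.1, hW.2, h⟩⟩
      rw [heq, hW.2]
    rw [Finset.sum_congr rfl this, Finset.sum_const, smul_eq_mul, mul_comm]
    rfl
  omega

/-! ## The step inequality, averaged -/

omit [DecidableEq α] in
/-- The (cyclic order, start) pairs are nonempty when `#α = n`. -/
lemma nonempty_pairs (hn : Fintype.card α = n) : Nonempty (Pairs α n) :=
  ⟨(Fintype.equivOfCardEq (by rw [ZMod.card, hn]), 0)⟩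

omit [DecidableEq α] [NeZero n] in
/-- A `k`-set `K₀` with an outside element `e₀` exists when `k < n = #α`. -/
lemma exists_card_eq_notMem (hn : Fintype.card α = n) {k : ℕ} (hk : k < n) :
    ∃ K₀ : Finset α, K₀.card = k ∧ ∃ e₀, e₀ ∉ K₀ := by
  obtain ⟨K₀, -, hK₀⟩ := Finset.exists_subset_card_eq (s := (univ : Finset α)) (n := k)
    (by rw [Finset.card_univ, hn]; exact hk.le)
  refine ⟨K₀, hK₀, ?_⟩
  obtain ⟨e₀, -, he₀⟩ := Finset.exists_mem_notMem_of_card_lt_card (s := K₀) (t := univ)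
    (by rw [hK₀, Finset.card_univ, hn]; exact hk)
  exact ⟨e₀, he₀⟩

/-- **`v_k ≤ #bdryPairs V k`** for an intersecting up-set and `2k ≤ n`: the per-cycle step inequality
`2 · #memberStarts ≤ (n − k) · (#bdryL + #bdryR)` summed over all cyclic orders, with the fibre counts. -/
theorem levelCount_le_card_bdryPairs (hn : Fintype.card α = n) {V : Finset (Finset α)}
    (hV : (V : Set (Finset α)).Intersecting) (hup : IsUpperSet (V : Set (Finset α))) {k : ℕ}
    (hk : 2 * k ≤ n) : levelCount V k ≤ (bdryPairs V k).card := by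
  have hkn : k < n := by have := NeZero.pos n; omega
  obtain ⟨K₀, hK₀, e₀, he₀⟩ := exists_card_eq_notMem hn hkn
  have hsum : ∑ σ : ZMod n ≃ α, 2 * (memberStarts V σ k).card ≤
      ∑ σ : ZMod n ≃ α, (n - k) * ((bdryL V σ k).card + (bdryR V σ k).card) :=
    Finset.sum_le_sum fun σ _ => two_mul_card_memberStarts_le hV hup σ hk
  rw [← Finset.mul_sum, ← Finset.mul_sum, Finset.sum_add_distrib, sum_card_memberStarts V hkn.le hK₀,
    sum_card_bdryL V hkn hK₀ he₀, sum_card_bdryR V hkn, sum_card_bdryL V hkn hK₀ he₀,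
    card_fib_eq_mul hn hkn hK₀ he₀] at hsum
  have hN₂ : 0 < (fib₂ n k K₀ e₀).card := by
    have h := card_fib_mul_choose hn hkn.le hK₀
    rw [card_fib_eq_mul hn hkn hK₀ he₀] at h
    have hc : 0 < Fintype.card (Pairs α n) := @Fintype.card_pos _ _ (nonempty_pairs hn)
    rcases Nat.eq_zero_or_pos (fib₂ n k K₀ e₀).card with h0 | h0
    · rw [h0, mul_zero, zero_mul] at h; omega
    · exact h0
  have hnk : 0 < n - k := by omega
  have key : levelCount V k * ((n - k) * (fib₂ n k K₀ e₀).card * 2) ≤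
      (bdryPairs V k).card * ((n - k) * (fib₂ n k K₀ e₀).card * 2) := by
    calc levelCount V k * ((n - k) * (fib₂ n k K₀ e₀).card * 2)
        = 2 * (levelCount V k * ((n - k) * (fib₂ n k K₀ e₀).card)) := by ring
      _ ≤ (n - k) * ((bdryPairs V k).card * (fib₂ n k K₀ e₀).card +
          (bdryPairs V k).card * (fib₂ n k K₀ e₀).card) := hsum
      _ = (bdryPairs V k).card * ((n - k) * (fib₂ n k K₀ e₀).card * 2) := by ring
  exact Nat.le_of_mul_le_mul_right key (by positivity)

/-- **THE STEP OF THE BOOLEAN (IO)**: `(n + 1 − k) · v_k ≤ (k + 1) · v_{k+1}` for an intersecting up-set and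
`2k ≤ n`. -/
theorem step_levelCount (hn : Fintype.card α = n) {V : Finset (Finset α)}
    (hV : (V : Set (Finset α)).Intersecting) (hup : IsUpperSet (V : Set (Finset α))) {k : ℕ}
    (hk : 2 * k ≤ n) : (n + 1 - k) * levelCount V k ≤ (k + 1) * levelCount V (k + 1) := by
  have h1 := levelCount_le_card_bdryPairs hn hV hup hk
  have h2 := card_bdryPairs_add hn hup k
  have hsplit : n + 1 - k = (n - k) + 1 := by omega
  rw [hsplit, add_mul, one_mul]
  calc (n - k) * levelCount V k + levelCount V k
      ≤ (n - k) * levelCount V k + (bdryPairs V k).card := Nat.add_le_add_left h1 _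
    _ = (k + 1) * levelCount V (k + 1) := by rw [add_comm]; exact h2

/-! ## The reflection inequality, averaged -/

omit [DecidableEq α] [NeZero n] in
/-- A `k`-set exists when `k ≤ n = #α`. -/
lemma exists_card_eq (hn : Fintype.card α = n) {k : ℕ} (hk : k ≤ n) : ∃ K : Finset α, K.card = k := by
  obtain ⟨K, -, hK⟩ := Finset.exists_subset_card_eq (s := (univ : Finset α)) (n := k)
    (by rw [Finset.card_univ, hn]; exact hk)
  exact ⟨K, hK⟩

/-- **THE REFLECTION OF THE BOOLEAN (IO)**: `v_{i+1} ≤ v_{n−i}` for an intersecting up-set and `2(i + 1) ≤ n`: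
the per-cycle reflection inequality summed over all cyclic orders, with `#fib(m) · C(n, m) = #pairs` for
`m = i + 1, n − i` and `(n − i) · C(n, i) = (i + 1) · C(n, i + 1)`. -/
theorem levelCount_le_levelCount_reflect (hn : Fintype.card α = n) {V : Finset (Finset α)}
    (hV : (V : Set (Finset α)).Intersecting) (hup : IsUpperSet (V : Set (Finset α))) {i : ℕ}
    (hi : 2 * (i + 1) ≤ n) : levelCount V (i + 1) ≤ levelCount V (n - i) := by
  obtain ⟨K₁, hK₁⟩ := exists_card_eq hn (k := i + 1) (by omega)
  obtain ⟨K₂, hK₂⟩ := exists_card_eq hn (k := n - i) (by omega)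
  have hsum : ∑ σ : ZMod n ≃ α, (n - i) * (memberStarts V σ (i + 1)).card ≤
      ∑ σ : ZMod n ≃ α, (i + 1) * (memberStarts V σ (n - i)).card :=
    Finset.sum_le_sum fun σ _ => card_memberStarts_mul_le hV hup σ hi
  rw [← Finset.mul_sum, ← Finset.mul_sum, sum_card_memberStarts V (by omega) hK₁,
    sum_card_memberStarts V (by omega) hK₂] at hsum
  have hc₁ := card_fib_mul_choose hn (by omega : i + 1 ≤ n) hK₁
  have hc₂ := card_fib_mul_choose hn (by omega : n - i ≤ n) hK₂
  rw [Nat.choose_symm (by omega : i ≤ n)] at hc₂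
  have hch : n.choose (i + 1) * (i + 1) = n.choose i * (n - i) := Nat.choose_succ_right_eq n i
  have hcpos : 0 < Fintype.card (Pairs α n) := @Fintype.card_pos _ _ (nonempty_pairs hn)
  have hchpos : 0 < n.choose (i + 1) := Nat.choose_pos (by omega)
  have key : levelCount V (i + 1) * (Fintype.card (Pairs α n) * ((i + 1) * n.choose (i + 1))) ≤
      levelCount V (n - i) * (Fintype.card (Pairs α n) * ((i + 1) * n.choose (i + 1))) := by
    calc levelCount V (i + 1) * (Fintype.card (Pairs α n) * ((i + 1) * n.choose (i + 1)))
        = levelCount V (i + 1) * (((fib n (i + 1) K₁).card * n.choose (i + 1)) *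
            (n.choose (i + 1) * (i + 1))) := by rw [hc₁]; ring
      _ = levelCount V (i + 1) * (((fib n (i + 1) K₁).card * n.choose (i + 1)) *
            (n.choose i * (n - i))) := by rw [hch]
      _ = ((n - i) * (levelCount V (i + 1) * (fib n (i + 1) K₁).card)) *
            (n.choose (i + 1) * n.choose i) := by ring
      _ ≤ ((i + 1) * (levelCount V (n - i) * (fib n (n - i) K₂).card)) *
            (n.choose (i + 1) * n.choose i) := Nat.mul_le_mul_right _ hsum
      _ = levelCount V (n - i) * (((fib n (n - i) K₂).card * n.choose i) *
            ((i + 1) * n.choose (i + 1))) := by ring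
      _ = levelCount V (n - i) * (Fintype.card (Pairs α n) * ((i + 1) * n.choose (i + 1))) := by rw [hc₂]
  exact Nat.le_of_mul_le_mul_right key (by positivity)

/-! ## The theorem -/

omit [Fintype α] [NeZero n] in
/-- The empty set is not a member of an intersecting family: `v_0 = 0`. -/
lemma levelCount_zero {V : Finset (Finset α)} (hV : (V : Set (Finset α)).Intersecting) :
    levelCount V 0 = 0 := by
  rw [levelCount, Finset.card_eq_zero, Finset.filter_eq_empty_iff]
  intro W hW hW0
  rw [Finset.card_eq_zero] at hW0
  have := hV.bot_notMem
  rw [Finset.bot_eq_empty, Finset.mem_coe] at this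
  exact this (hW0 ▸ hW)

/-- **THE BOOLEAN (IO), `NeZero n` form**: for an intersecting up-set `V` of subsets of `α` with `#α = n ≥ 1`,
`NormSkew (levelCount V) (n + 1)`. -/
theorem normSkew_levelCount_of_intersecting_aux (hn : Fintype.card α = n) {V : Finset (Finset α)}
    (hV : (V : Set (Finset α)).Intersecting) (hup : IsUpperSet (V : Set (Finset α))) :
    SkewConv.NormSkew (levelCount V) (n + 1) := by
  apply SkewConv.normSkew_of_step_of_reflect
  · intro k hk
    have hstep := step_levelCount hn hV hup (k := k) (by omega)
    have hch := Nat.choose_succ_right_eq (n + 1) k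
    refine Nat.le_of_mul_le_mul_right (c := k + 1) ?_ (Nat.succ_pos k)
    calc levelCount V k * (n + 1).choose (k + 1) * (k + 1)
        = levelCount V k * ((n + 1).choose (k + 1) * (k + 1)) := by ring
      _ = levelCount V k * ((n + 1).choose k * (n + 1 - k)) := by rw [hch]
      _ = ((n + 1 - k) * levelCount V k) * (n + 1).choose k := by ring
      _ ≤ ((k + 1) * levelCount V (k + 1)) * (n + 1).choose k := Nat.mul_le_mul_right _ hstep
      _ = levelCount V (k + 1) * (n + 1).choose k * (k + 1) := by ring
  · intro i hi
    rcases i with _ | i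
    · rw [levelCount_zero hV]; exact Nat.zero_le _
    · have := levelCount_le_levelCount_reflect hn hV hup (i := i) (by omega)
      rwa [show n + 1 - (i + 1) = n - i by omega]

omit [NeZero n] in
/-- **THE BOOLEAN (IO)** (night-1 g33, Katona's cycle method): for every intersecting up-set `V` of subsets of a
finite type `α` with `n` elements, the level profile `v_k = #{W ∈ V : #W = k}` satisfies the normalized half rule
with parameter `n + 1`: `v_i · C(n + 1, j) ≤ v_j · C(n + 1, i)` for all `i < j` with `i + j ≤ n + 1`. -/
theorem normSkew_levelCount_of_intersecting (hn : Fintype.card α = n) {V : Finset (Finset α)}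
    (hV : (V : Set (Finset α)).Intersecting) (hup : IsUpperSet (V : Set (Finset α))) :
    SkewConv.NormSkew (levelCount V) (n + 1) := by
  rcases Nat.eq_zero_or_pos n with rfl | hpos
  · have hempty : IsEmpty α := Fintype.card_eq_zero_iff.mp hn
    have hV0 : ∀ k, levelCount V k = 0 := by
      intro k
      rw [levelCount, Finset.card_eq_zero, Finset.filter_eq_empty_iff]
      intro W hW _
      have hWe : W = ∅ := Finset.eq_empty_of_isEmpty W
      have := hV.bot_notMem
      rw [Finset.bot_eq_empty, Finset.mem_coe] at this
      exact this (hWe ▸ hW)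
    intro i j _ _
    simp [hV0]
  · haveI : NeZero n := ⟨hpos.ne'⟩
    exact normSkew_levelCount_of_intersecting_aux hn hV hup

omit [NeZero n] in
/-- **THE BOOLEAN (IO)**, parameter `#α + 1`. -/
theorem normSkew_levelCount_of_intersecting' {V : Finset (Finset α)}
    (hV : (V : Set (Finset α)).Intersecting) (hup : IsUpperSet (V : Set (Finset α))) :
    SkewConv.NormSkew (levelCount V) (Fintype.card α + 1) :=
  normSkew_levelCount_of_intersecting rfl hV hup

end Cycle

end PercRepro
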